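import Summits.BirchSwinnertonDyer.BirchSwinnertonDyer.Theorems.SignedLowerHalvesSmallImageLowerHalfBothSignsRttCharRoadE2CoeffStructure
import HarnessLib

/-!
# Route `SignedLowerHalves`, crux L `SmallImageLowerHalfBothSigns` (stmt-BirchSwinnertonDyer-23599), line `rtt_w3` v13 — E2, row D2-seq (1′), LEAD:
# `Λ_𝒪`-LINEARITY FROM `Λ`-LINEARITY AND `𝒪`-LINEARITY (every `F ∈ Λ_𝒪 = 𝒪⟦T⟧` is a finite sum `Σ C(a_i)·ι(r_i)`)

WHY (BRIEF-E2 rev 3.1 §2 rows `gX`, `Q`, `Lines/rtt_w3-BRIEF-E2-g9b.md`). The glue `charRoad_E2_of_localisation` (p776213) wants `gX : Q →ₗ[Λ_𝒪] X'`; the natural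
candidate is a TRANSPOSE `loc_v^∨` of Pontryagin duals (tree `IwasawaDual.dualHom`), known to be `Λ = ℤ_p⟦T⟧`-linear (`IwasawaDual.dualHom_smul`) and to
commute with the transposed scalars `C a`, `a ∈ 𝒪` (`…RttCharRoadE2DualOStructure`: `toDual ((C a)•x) = toDual x ∘ scalarH1 a`). This file turns those two
commutations into full `Λ_𝒪`-linearity: since `𝒪 = padicCoeffIntegers S` is finite free over `ℤ_p`, every `F ∈ Λ_𝒪` is a FINITE sum `Σ_i C(a_i)·ι(r_i)`
(`exists_eq_sum_C_mul_iwasawaToIwasawaO`, `ι = iwasawaToIwasawaO S`), so an additive map between `Λ_𝒪`-modules commuting with every `ι(r)•` and every `C(a)•`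
is `Λ_𝒪`-linear (`map_smul_of_commute_C_iwasawaToIwasawaO`). THEOREMS ONLY; nothing about E2 itself is proved. [cite: Washington1997, §13.2] [folklore]
-/

set_option linter.dupNamespace false -- D-0017: single-problem summit, the namespace repeats the problem name by design
set_option autoImplicit false

noncomputable section

namespace Summit.BirchSwinnertonDyer.BirchSwinnertonDyer.Theorems.SmallImageRttCharRoad

open PowerSeries Literature.NumberTheory.EllipticCurves

universe u v

variable {p : ℕ} [Fact p.Prime] (S : Set (PadicAlgCl p)) [FiniteDimensional ℚ_[p] (padicCoeffField S)]

/-- **Every `F ∈ Λ_𝒪 = 𝒪⟦T⟧` is a finite sum `Σ_i C(a_i) · ι(r_i)`** with `a_i ∈ 𝒪`, `r_i ∈ Λ = ℤ_p⟦T⟧`, `ι = iwasawaToIwasawaO S` — coefficientwise expansion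
on a `ℤ_p`-basis of the finite free `𝒪 = padicCoeffIntegers S`. [folklore] -/
theorem exists_eq_sum_C_mul_iwasawaToIwasawaO (F : IwasawaAlgebraO S) :
    ∃ (n : ℕ) (a : Fin n → padicCoeffIntegers S) (r : Fin n → IwasawaAlgebra p),
      F = ∑ i, PowerSeries.C (a i) * iwasawaToIwasawaO S (r i) := by
  classical
  letI : Algebra ℤ_[p] (padicCoeffIntegers S) := (padicIntToCoeffIntegers S).toAlgebra
  obtain ⟨hfree, hfin⟩ := moduleFree_finite_padicCoeffIntegers S
  haveI := hfree
  haveI := hfin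
  let b := Module.Free.chooseBasis ℤ_[p] (padicCoeffIntegers S)
  -- reindex the finite basis by `Fin n`
  let eι := Fintype.equivFin (Module.Free.ChooseBasisIndex ℤ_[p] (padicCoeffIntegers S))
  refine ⟨Fintype.card (Module.Free.ChooseBasisIndex ℤ_[p] (padicCoeffIntegers S)), fun i ↦ b (eι.symm i),
    fun i ↦ PowerSeries.mk fun k ↦ b.repr (PowerSeries.coeff k F) (eι.symm i), ?_⟩
  refine PowerSeries.ext fun k ↦ ?_
  rw [map_sum]
  have hterm : ∀ i, PowerSeries.coeff k (PowerSeries.C (b (eι.symm i)) *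
      iwasawaToIwasawaO S (PowerSeries.mk fun k ↦ b.repr (PowerSeries.coeff k F) (eι.symm i))) =
      (b.repr (PowerSeries.coeff k F) (eι.symm i)) • b (eι.symm i) := fun i ↦ by
    rw [PowerSeries.coeff_C_mul, iwasawaToIwasawaO, PowerSeries.coeff_map, PowerSeries.coeff_mk, Algebra.smul_def,
      RingHom.algebraMap_toAlgebra, mul_comm]
  simp_rw [hterm]
  rw [Equiv.sum_comp eι.symm (fun j ↦ (b.repr (PowerSeries.coeff k F) j) • b j)]
  exact (b.sum_repr (PowerSeries.coeff k F)).symm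

/-- **`Λ_𝒪`-linearity from the two commutations.** An additive map between `Λ_𝒪`-modules which commutes with the action of every `ι(r)`, `r ∈ Λ`, and of
every constant `C a`, `a ∈ 𝒪`, is `Λ_𝒪`-linear. (Use: the transpose `gX = loc_v^∨` — `Λ`-linear by `IwasawaDual.dualHom_smul`, `C a`-compatible by the transpose
law of `…RttCharRoadE2DualOStructure`.) [folklore] -/
theorem map_smul_of_commute_C_iwasawaToIwasawaO {X : Type u} {Y : Type v} [AddCommGroup X] [Module (IwasawaAlgebraO S) X]
    [AddCommGroup Y] [Module (IwasawaAlgebraO S) Y] (Φ : X →+ Y)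
    (hΛ : ∀ (r : IwasawaAlgebra p) (x : X), Φ (iwasawaToIwasawaO S r • x) = iwasawaToIwasawaO S r • Φ x)
    (hC : ∀ (a : padicCoeffIntegers S) (x : X), Φ ((PowerSeries.C a : IwasawaAlgebraO S) • x) = (PowerSeries.C a : IwasawaAlgebraO S) • Φ x)
    (F : IwasawaAlgebraO S) (x : X) : Φ (F • x) = F • Φ x := by
  obtain ⟨n, a, r, rfl⟩ := exists_eq_sum_C_mul_iwasawaToIwasawaO S F
  rw [Finset.sum_smul, Finset.sum_smul, map_sum]
  refine Finset.sum_congr rfl fun i _ ↦ ?_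
  rw [mul_smul, mul_smul, hC, hΛ]

end Summit.BirchSwinnertonDyer.BirchSwinnertonDyer.Theorems.SmallImageRttCharRoad

end
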